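import Mathlib.NumberTheory.ArithmeticFunction.Misc
import Mathlib.Analysis.SpecialFunctions.Pow.NNReal
import HarnessLib

/-!
# The divisor bound `τ(n) ≪_ε n^ε`

Topic `Literature/NumberTheory/Sieve` (elementary multiplicative input, next to
`SmallDivisorLemma.lean`).  Hardy–Wright, *An Introduction to the Theory of Numbers* (6th ed., OUP
2008), Thm 315 (§18.1, PDF p. 204 of the held copy `book:hardy2008-introduction-theory-numbers`):
"`d(n) = O(n^δ)` for all positive `δ`", where `d(n) = τ(n) = #(Nat.divisors n)`; the "direct" proof
with (18.1.2)–(18.1.3) is on PDF pp. 204–205.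

* `Literature.NumberTheory.Sieve.exists_card_divisors_le_mul_rpow` (PROVED): for every `ε > 0` there is `C = C(ε) ≥ 1` with
  `τ(n) ≤ C n^ε` for all `n ≥ 1`;
* `Literature.NumberTheory.Sieve.exists_card_divisors_le_mul_rpow'` (PROVED): the same for all `n` (at `n = 0` both sides
  vanish, Mathlib's `Nat.divisors 0 = ∅`).

Proof (Hardy–Wright's "direct" proof, §18.1, (18.1.2)–(18.1.3)): `τ(n)/n^δ = ∏_{p^a ∥ n} (a+1)/p^{aδ}`;
for `p ≥ 2^{1/δ}` the factor is `≤ (a+1)/2^a ≤ 1`, and for each of the finitely many `p < 2^{1/δ}`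
it is `≤ 1 + a/(p^{aδ}) ≤ 1 + 1/(δ log 2)` (from `p^{aδ} ≥ 2^{aδ} = e^{aδ log 2} ≥ 1 + aδ log 2`), so
`τ(n) ≤ (1 + 1/(δ log 2))^{2^{1/δ}} n^δ`.

Mathlib has `Nat.card_divisors` (`τ(n) = ∏ (a_p + 1)`), `Nat.card_divisors_le_self`, but no
`n^ε` bound (searched: `card_divisors_le`, `divisor_bound`).
-/

open Finset

namespace Literature.NumberTheory.Sieve

/-- **The divisor bound** (Hardy–Wright Thm 315: `d(n) = O(n^δ)` for every `δ > 0`), with an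
explicit admissible constant: for `ε > 0` there is `C ≥ 1` (one may take
`C = (1 + 1/(ε log 2))^{⌈2^{1/ε}⌉}`) such that `τ(n) ≤ C · n^ε` for all `n ≥ 1`.
[cite: HardyWright2008, Theorem 315] -/
theorem exists_card_divisors_le_mul_rpow {ε : ℝ} (hε : 0 < ε) :
    ∃ C : ℝ, 1 ≤ C ∧ ∀ n : ℕ, n ≠ 0 → (#n.divisors : ℝ) ≤ C * (n : ℝ) ^ ε := by
  have hlog2 : 0 < Real.log 2 := Real.log_pos (by norm_num)
  set K : ℝ := 1 + 1 / (ε * Real.log 2) with hK_def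
  have hK1 : 1 ≤ K := le_add_of_nonneg_right (by positivity)
  set B : ℕ := ⌈(2 : ℝ) ^ (1 / ε)⌉₊ with hB_def
  refine ⟨K ^ B, one_le_pow₀ hK1, fun n hn => ?_⟩
  -- the local factor at each prime: `a + 1 ≤ (K or 1) · (p^a)^ε`
  have key : ∀ p ∈ n.primeFactors,
      ((n.factorization p + 1 : ℕ) : ℝ) ≤
        (if (p : ℝ) < (2 : ℝ) ^ (1 / ε) then K else 1) *
          (((p : ℝ) ^ n.factorization p) ^ ε) := by
    intro p hp
    have hp' : p.Prime := Nat.prime_of_mem_primeFactors hp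
    have hp2 : (2 : ℝ) ≤ (p : ℝ) := by exact_mod_cast hp'.two_le
    set a : ℕ := n.factorization p with ha_def
    by_cases hcase : (p : ℝ) < (2 : ℝ) ^ (1 / ε)
    · -- small prime: `a + 1 ≤ (1 + 1/(ε log 2)) (p^a)^ε`
      rw [if_pos hcase]
      have hbase : ((2 : ℝ) ^ (a : ℕ)) ^ ε ≤ ((p : ℝ) ^ (a : ℕ)) ^ ε := by
        apply Real.rpow_le_rpow (by positivity) _ hε.le
        exact pow_le_pow_left₀ (by norm_num) hp2 a
      have hexp : ((2 : ℝ) ^ (a : ℕ)) ^ ε = Real.exp ((a : ℝ) * ε * Real.log 2) := by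
        rw [← Real.rpow_natCast (2 : ℝ) a, ← Real.rpow_mul (by norm_num : (0:ℝ) ≤ 2),
          Real.rpow_def_of_pos (by norm_num : (0:ℝ) < 2)]
        ring_nf
      have haT : (a : ℝ) * (ε * Real.log 2) ≤ ((p : ℝ) ^ (a : ℕ)) ^ ε := by
        refine le_trans ?_ hbase
        rw [hexp]
        have := Real.add_one_le_exp ((a : ℝ) * ε * Real.log 2)
        nlinarith [this]
      have hεlog : (0 : ℝ) < ε * Real.log 2 := by positivity
      have hexpand : K * (((p : ℝ) ^ (a : ℕ)) ^ ε) =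
          ((p : ℝ) ^ (a : ℕ)) ^ ε + ((p : ℝ) ^ (a : ℕ)) ^ ε / (ε * Real.log 2) := by
        rw [hK_def]; field_simp
      have h1T : (1 : ℝ) ≤ ((p : ℝ) ^ (a : ℕ)) ^ ε :=
        Real.one_le_rpow (one_le_pow₀ (by linarith)) hε.le
      have haT' : (a : ℝ) ≤ ((p : ℝ) ^ (a : ℕ)) ^ ε / (ε * Real.log 2) :=
        (le_div_iff₀ hεlog).mpr haT
      push_cast
      rw [hexpand]
      linarith
    · -- large prime `p ≥ 2^{1/ε}`: `a + 1 ≤ 2^a ≤ (p^a)^ε`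
      rw [if_neg hcase, one_mul]
      have h2p : (2 : ℝ) ^ (1 / ε) ≤ (p : ℝ) := not_lt.mp hcase
      have e1 : (((2 : ℝ) ^ (1 / ε)) ^ (a : ℕ)) ^ ε ≤ (((p : ℝ)) ^ (a : ℕ)) ^ ε := by
        apply Real.rpow_le_rpow (by positivity) _ hε.le
        exact pow_le_pow_left₀ (by positivity) h2p a
      have e2 : (((2 : ℝ) ^ (1 / ε)) ^ (a : ℕ)) ^ ε = (2 : ℝ) ^ (a : ℕ) := by
        rw [← Real.rpow_natCast ((2 : ℝ) ^ (1 / ε)) a,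
          ← Real.rpow_mul (by norm_num : (0:ℝ) ≤ 2),
          ← Real.rpow_mul (by norm_num : (0:ℝ) ≤ 2),
          ← Real.rpow_natCast (2 : ℝ) a]
        congr 1
        field_simp
      have e3 : ((a : ℕ) + 1 : ℝ) ≤ (2 : ℝ) ^ (a : ℕ) := by
        exact_mod_cast Nat.lt_two_pow_self
      push_cast at e3 ⊢
      calc (a : ℝ) + 1 ≤ (2 : ℝ) ^ (a : ℕ) := e3
        _ = (((2 : ℝ) ^ (1 / ε)) ^ (a : ℕ)) ^ ε := e2.symm
        _ ≤ (((p : ℝ)) ^ (a : ℕ)) ^ ε := e1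
  have hτ : (#n.divisors : ℝ) = ∏ p ∈ n.primeFactors, ((n.factorization p + 1 : ℕ) : ℝ) := by
    rw [Nat.card_divisors hn, Nat.cast_prod]
  have hself : ∏ p ∈ n.primeFactors, p ^ n.factorization p = n :=
    (Nat.prod_primeFactors_pow_factorization hn).symm
  have hnε : (n : ℝ) ^ ε = ∏ p ∈ n.primeFactors, (((p : ℝ) ^ n.factorization p) ^ ε) := by
    rw [Real.finsetProd_rpow _ _ (fun p _ => by positivity) ε]
    congr 1
    conv_lhs => rw [← hself]
    push_cast
    rfl
  have hsmall : ∏ p ∈ n.primeFactors, (if (p : ℝ) < (2 : ℝ) ^ (1 / ε) then K else 1) ≤ K ^ B := by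
    rw [Finset.prod_ite, Finset.prod_const, Finset.prod_const_one, mul_one]
    have hcard : (n.primeFactors.filter fun p : ℕ => (p : ℝ) < (2 : ℝ) ^ (1 / ε)).card ≤ B := by
      have hsub : (n.primeFactors.filter fun p : ℕ => (p : ℝ) < (2 : ℝ) ^ (1 / ε))
          ⊆ Finset.range B := by
        intro p hp
        rw [Finset.mem_range]
        exact Nat.lt_ceil.mpr (Finset.mem_filter.mp hp).2
      exact le_trans (Finset.card_le_card hsub) (by rw [Finset.card_range])
    exact pow_le_pow_right₀ hK1 hcard
  calc (#n.divisors : ℝ) = ∏ p ∈ n.primeFactors, ((n.factorization p + 1 : ℕ) : ℝ) := hτ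
    _ ≤ ∏ p ∈ n.primeFactors,
          ((if (p : ℝ) < (2 : ℝ) ^ (1 / ε) then K else 1) *
            (((p : ℝ) ^ n.factorization p) ^ ε)) := by
        refine Finset.prod_le_prod (fun p _ => by positivity) key
    _ = (∏ p ∈ n.primeFactors, (if (p : ℝ) < (2 : ℝ) ^ (1 / ε) then K else 1)) *
          ∏ p ∈ n.primeFactors, (((p : ℝ) ^ n.factorization p) ^ ε) :=
        Finset.prod_mul_distrib
    _ ≤ K ^ B * (n : ℝ) ^ ε := by
        rw [← hnε]
        refine mul_le_mul_of_nonneg_right hsmall (by positivity)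

/-- The divisor bound for all `n` (at `n = 0`, `Nat.divisors 0 = ∅` and both sides vanish).
[cite: HardyWright2008, Theorem 315] -/
theorem exists_card_divisors_le_mul_rpow' {ε : ℝ} (hε : 0 < ε) :
    ∃ C : ℝ, 1 ≤ C ∧ ∀ n : ℕ, (#n.divisors : ℝ) ≤ C * (n : ℝ) ^ ε := by
  obtain ⟨C, hC1, hC⟩ := exists_card_divisors_le_mul_rpow hε
  refine ⟨C, hC1, fun n => ?_⟩
  rcases eq_or_ne n 0 with rfl | hn
  · simp [Real.zero_rpow hε.ne']
  · exact hC n hn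

/-- The divisor bound in `σ₀`-form: `σ₀(n) ≤ C n^ε` for `n ≥ 1` (Mathlib:
`ArithmeticFunction.sigma 0 n = #n.divisors`). [cite: HardyWright2008, Theorem 315] -/
theorem exists_sigma_zero_le_mul_rpow {ε : ℝ} (hε : 0 < ε) :
    ∃ C : ℝ, 1 ≤ C ∧ ∀ n : ℕ, ((ArithmeticFunction.sigma 0 n : ℕ) : ℝ) ≤ C * (n : ℝ) ^ ε := by
  obtain ⟨C, hC1, hC⟩ := exists_card_divisors_le_mul_rpow' hε
  exact ⟨C, hC1, fun n => by rw [ArithmeticFunction.sigma_zero_apply]; exact hC n⟩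

end Literature.NumberTheory.Sieve
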